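import Literature.NumberTheory.PAdicHodge.TateSenCocycles
import Mathlib.LinearAlgebra.Matrix.NonsingularInverse
import Mathlib.Topology.Instances.Matrix
import Mathlib.Analysis.Normed.Group.Ultra
import Mathlib.Analysis.SpecificLimits.Basic
import HarnessLib

/-!
# Tate–Sen for `GL_d`: continuous `1`-cocycles close to `1` are coboundaries under (TS1)
# (Berger–Colmez, Lemme 3.2.1 and Cor. 3.2.2)

Companion of `TateSenCocycles`, which proves the ADDITIVE case `d = 1` (`H¹_cont(G, C) = 0`) of the
Tate–Sen descent along a group satisfying the almost étale condition (TS1). This file proves the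
non-abelian version for `GL_d`, in the same abstract setting: a compact topological group `G` in which every
neighbourhood of `1` contains an open subgroup, acting on a complete ultrametric normed field `C` by isometric
ring automorphisms, continuously in the group variable, with the Tate–Sen condition (TS1) with constant `K`:
every open subgroup `U` admits a `U`-invariant `α ∈ C` with `‖α‖ ≤ K` and `∑_{q ∈ G/U} q(α) = 1`.
Matrices are over a finite index type `m` and are measured ENTRYWISE (the sup norm is ultrametric and
submultiplicative, `norm_mul_apply_le`); `g ∈ G` acts on a matrix entrywise, `M ↦ M.map (g • ·)`.

* `TateSen.GL_step` — **Berger–Colmez Lemme 3.2.1.** If `σ ↦ U_σ ∈ M_d(C)` is a continuous `1`-cocycle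
  (`U_{στ} = U_σ σ(U_τ)`) with `‖U_σ − 1‖ ≤ s` for all `σ`, where `K s < 1`, then there is `M` with
  `‖M − 1‖ ≤ K s` (so `M ∈ GL_d`) and `‖M⁻¹ U_σ σ(M) − 1‖ ≤ s / 2` for all `σ`. (`M = ∑_{q ∈ G/U} q(α) U_q`
  for an open subgroup `U` on which `‖U_σ − 1‖ ≤ s/(2K)`.)
* ★ `TateSen.GL_exists_conj_eq_one_of_TS1` — **Berger–Colmez Cor. 3.2.2 (the `H`-descent of Sen's
  method).** Under the same hypotheses there is `P ∈ GL_d(C)` with `‖P − 1‖ ≤ K s` and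
  `P⁻¹ U_σ σ(P) = 1` for every `σ ∈ G`: the cocycle is the coboundary of `P`. Proof: iterate `GL_step`,
  the product `M₀ M₁ ⋯` converges since `‖M_k − 1‖ ≤ K s 2^{-k}`.

Everything is proved; no named fact, no definition, no instance. With `G = H_F = ker χ` acting on `ℂ_F`
((TS1) = the tree's theorem `tate1967_TS1_completedAlgClosure_holds`) this is the first half of Sen's theorem
(`H¹(H_F, GL_d(ℂ_F)) = 1` near the identity); the second half (decompletion along `Γ`) is
`SenDecompletionMatrix` / `SenDecompletionCocycle`.

## References

* L. Berger, P. Colmez, *Familles de représentations de de Rham et monodromie p-adique*, Astérisque 319 (2008),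
  Déf. 3.1.3 (TS1), Lemme 3.2.1, Cor. 3.2.2. [BergerColmez2008]
* S. Sen, *Continuous cohomology and p-adic Galois representations*, Invent. Math. 62 (1980). [Sen1980]
* J. Tate, *p-divisible groups* (1967), §3.2 Prop. 9–10. [Tate1967]
-/

noncomputable section

open scoped Topology
open Filter

namespace Literature.NumberTheory.PAdicHodge.TateSen

section Abstract

variable {G : Type*} [Group G] {C : Type*} [NormedField C] [MulSemiringAction G C]
variable {m : Type} [Fintype m] [DecidableEq m]

/-! ### Ultrametric matrix toolkit (entrywise sup norm) -/

section Toolkit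

variable [IsUltrametricDist C]

omit [DecidableEq m] in
/-- Entrywise bounds are submultiplicative over an ultrametric field. [folklore] -/
private theorem norm_mul_apply_le {A B : Matrix m m C} {a b : ℝ} (ha : 0 ≤ a) (hb : 0 ≤ b)
    (hA : ∀ i j, ‖A i j‖ ≤ a) (hB : ∀ i j, ‖B i j‖ ≤ b) (i j : m) : ‖(A * B) i j‖ ≤ a * b := by
  rw [Matrix.mul_apply]
  exact IsUltrametricDist.norm_sum_le_of_forall_le_of_nonneg (mul_nonneg ha hb)
    fun k _ => by rw [norm_mul]; exact mul_le_mul (hA i k) (hB k j) (norm_nonneg _) ha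

omit [Fintype m] [DecidableEq m] in
/-- `‖(A + B) i j‖ ≤ max`. [folklore] -/
private theorem norm_add_apply_le {A B : Matrix m m C} {a b : ℝ} (hA : ∀ i j, ‖A i j‖ ≤ a)
    (hB : ∀ i j, ‖B i j‖ ≤ b) (i j : m) : ‖(A + B) i j‖ ≤ max a b := by
  rw [Matrix.add_apply]
  exact (IsUltrametricDist.norm_add_le_max _ _).trans (max_le_max (hA i j) (hB i j))

/-- `‖1 + c‖ = 1` when `‖c‖ < 1`. [folklore] -/
private theorem norm_one_add_eq {c : C} (hc : ‖c‖ < 1) : ‖1 + c‖ = 1 := by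
  have h := IsUltrametricDist.norm_add_eq_max_of_norm_ne_norm (x := (1 : C)) (y := c)
    (by rw [norm_one]; exact hc.ne')
  rw [h, norm_one, max_eq_left hc.le]

/-- The determinant of a matrix with entries of norm `≤ 1` has norm `≤ 1`. [folklore] -/
private theorem norm_det_le_one {A : Matrix m m C} (hA : ∀ i j, ‖A i j‖ ≤ 1) : ‖A.det‖ ≤ 1 := by
  rw [Matrix.det_apply']
  refine IsUltrametricDist.norm_sum_le_of_forall_le_of_nonneg zero_le_one fun σ _ => ?_
  have h1 : ‖(((Equiv.Perm.sign σ : ℤˣ) : ℤ) : C)‖ = 1 := by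
    rcases Int.units_eq_one_or (Equiv.Perm.sign σ) with h | h <;> simp [h]
  rw [norm_mul, h1, one_mul, norm_prod]
  exact Finset.prod_le_one (fun i _ => norm_nonneg _) fun i _ => hA _ _

omit [Fintype m] in
/-- Entries of `1 + C`, `‖C‖ ≤ r ≤ 1`: norm `≤ 1`, and the off-diagonal ones `≤ r`. [folklore] -/
private theorem norm_one_add_apply_le {E : Matrix m m C} {r : ℝ} (hr1 : r ≤ 1)
    (hE : ∀ i j, ‖E i j‖ ≤ r) (i j : m) :
    ‖(1 + E : Matrix m m C) i j‖ ≤ 1 ∧ (i ≠ j → ‖(1 + E : Matrix m m C) i j‖ ≤ r) := by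
  rw [Matrix.add_apply]
  by_cases hij : i = j
  · subst hij
    rw [Matrix.one_apply_eq]
    refine ⟨(IsUltrametricDist.norm_add_le_max _ _).trans ?_, fun h => (h rfl).elim⟩
    rw [norm_one]; exact max_le le_rfl ((hE i i).trans hr1)
  · rw [Matrix.one_apply_ne hij, zero_add]
    exact ⟨(hE i j).trans hr1, fun _ => hE i j⟩

omit [Fintype m] [DecidableEq m] in
/-- Entries of `B` with `‖B − 1‖ ≤ r ≤ 1` have norm `≤ 1`. [folklore] -/
private theorem norm_apply_le_one_of_norm_sub_one_le [DecidableEq m] {B : Matrix m m C} {r : ℝ}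
    (hr1 : r ≤ 1) (hB : ∀ i j, ‖(B - 1) i j‖ ≤ r) (i j : m) : ‖B i j‖ ≤ 1 := by
  have h := (norm_one_add_apply_le hr1 hB i j).1
  rwa [add_sub_cancel] at h

omit [Fintype m] in
/-- `‖∏ (1 + c_i) − 1‖ ≤ r` when all `‖c_i‖ ≤ r ≤ 1`. [folklore] -/
private theorem norm_prod_one_add_sub_one_le {s : Finset m} {c : m → C} {r : ℝ} (hr0 : 0 ≤ r)
    (hr1 : r ≤ 1) (hc : ∀ i, ‖c i‖ ≤ r) : ‖∏ i ∈ s, (1 + c i) - 1‖ ≤ r := by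
  induction s using Finset.induction_on with
  | empty => rw [Finset.prod_empty, sub_self, norm_zero]; exact hr0
  | @insert a s ha ih =>
    rw [Finset.prod_insert ha]
    set P := ∏ i ∈ s, (1 + c i)
    have hP : ‖P‖ ≤ 1 := by
      have h := IsUltrametricDist.norm_add_le_max (P - 1) 1
      rw [sub_add_cancel, norm_one] at h
      exact h.trans (max_le (ih.trans hr1) le_rfl)
    have h : (1 + c a) * P - 1 = (P - 1) + c a * P := by ring
    rw [h]
    refine (IsUltrametricDist.norm_add_le_max _ _).trans (max_le ih ?_)
    rw [norm_mul]
    calc ‖c a‖ * ‖P‖ ≤ r * 1 := mul_le_mul (hc a) hP (norm_nonneg _) hr0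
      _ = r := mul_one r

/-- `‖det(1 + E) − 1‖ ≤ ‖E‖` for `‖E‖ < 1`. [folklore] -/
private theorem norm_det_one_add_sub_one_le {E : Matrix m m C} {r : ℝ} (hr0 : 0 ≤ r) (hr1 : r < 1)
    (hE : ∀ i j, ‖E i j‖ ≤ r) : ‖(1 + E : Matrix m m C).det - 1‖ ≤ r := by
  have hent := norm_one_add_apply_le hr1.le hE
  rw [Matrix.det_apply', ← Finset.sum_erase_add _ _ (Finset.mem_univ (1 : Equiv.Perm m))]
  simp only [Equiv.Perm.sign_one, Units.val_one, Int.cast_one, one_mul, Equiv.Perm.one_apply]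
  rw [add_sub_assoc]
  refine (IsUltrametricDist.norm_add_le_max _ _).trans (max_le ?_ ?_)
  · refine IsUltrametricDist.norm_sum_le_of_forall_le_of_nonneg hr0 fun σ hσ => ?_
    have hσ1 : σ ≠ 1 := Finset.ne_of_mem_erase hσ
    obtain ⟨i₀, hi₀⟩ : ∃ i, σ i ≠ i := not_forall.mp fun h => hσ1 (Equiv.ext h)
    have h1 : ‖(((Equiv.Perm.sign σ : ℤˣ) : ℤ) : C)‖ = 1 := by
      rcases Int.units_eq_one_or (Equiv.Perm.sign σ) with h | h <;> simp [h]
    rw [norm_mul, h1, one_mul, ← Finset.prod_erase_mul _ _ (Finset.mem_univ i₀), norm_mul]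
    calc ‖∏ i ∈ Finset.univ.erase i₀, (1 + E : Matrix m m C) (σ i) i‖ * ‖(1 + E : Matrix m m C) (σ i₀) i₀‖
          ≤ 1 * r := by
          refine mul_le_mul ?_ ((hent _ _).2 hi₀) (norm_nonneg _) zero_le_one
          rw [norm_prod]
          exact Finset.prod_le_one (fun i _ => norm_nonneg _) fun i _ => (hent _ _).1
      _ = r := one_mul r
  · simp only [Matrix.add_apply, Matrix.one_apply_eq]
    exact norm_prod_one_add_sub_one_le hr0 hr1.le fun i => hE i i

/-- `‖det(1 + E)‖ = 1` for `‖E‖ < 1`. [folklore] -/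
private theorem norm_det_one_add_eq_one {E : Matrix m m C} {r : ℝ} (hr0 : 0 ≤ r) (hr1 : r < 1)
    (hE : ∀ i j, ‖E i j‖ ≤ r) : ‖(1 + E : Matrix m m C).det‖ = 1 := by
  have h := norm_det_one_add_sub_one_le hr0 hr1 hE
  have h1 : (1 + E : Matrix m m C).det = 1 + ((1 + E : Matrix m m C).det - 1) := by ring
  rw [h1]
  exact norm_one_add_eq (h.trans_lt hr1)

/-- **`B` with `‖B − 1‖ ≤ r < 1` is invertible and `‖B⁻¹‖ ≤ 1`** (entrywise). [folklore] -/
private theorem isUnit_det_and_norm_inv_le {B : Matrix m m C} {r : ℝ} (hr0 : 0 ≤ r) (hr1 : r < 1)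
    (hB : ∀ i j, ‖(B - 1) i j‖ ≤ r) : IsUnit B.det ∧ ∀ i j, ‖B⁻¹ i j‖ ≤ 1 := by
  have hB1 : B = 1 + (B - 1) := by abel
  have hdet := norm_det_one_add_eq_one hr0 hr1 hB
  rw [← hB1] at hdet
  refine ⟨isUnit_iff_ne_zero.mpr fun h0 => ?_, fun i j => ?_⟩
  · rw [h0, norm_zero] at hdet; exact zero_ne_one hdet
  · have hent := norm_one_add_apply_le hr1.le hB
    rw [Matrix.inv_def, Matrix.smul_apply, smul_eq_mul, Ring.inverse_eq_inv, norm_mul, norm_inv, hdet,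
      inv_one, one_mul, Matrix.adjugate_apply]
    refine norm_det_le_one fun i' j' => ?_
    rw [Matrix.updateRow_apply]
    split_ifs with h
    · by_cases hij : j' = i
      · subst hij; rw [Pi.single_eq_same, norm_one]
      · rw [Pi.single_eq_of_ne hij, norm_zero]; exact zero_le_one
    · rw [hB1]; exact (hent _ _).1

end Toolkit

/-! ### The entrywise action on matrices -/

omit [Fintype m] [DecidableEq m] in
/-- `g(c • A) = g(c) • g(A)`. [folklore] -/
private theorem map_smul_matrix (g : G) (c : C) (A : Matrix m m C) :
    (c • A).map (fun x => g • x) = (g • c) • A.map (fun x => g • x) := by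
  ext i j
  simp only [Matrix.map_apply, Matrix.smul_apply, smul_eq_mul, smul_mul']

omit [Fintype m] [DecidableEq m] in
/-- `g(∑ A_q) = ∑ g(A_q)`. [folklore] -/
private theorem map_sum_matrix {ι : Type*} (s : Finset ι) (g : G) (A : ι → Matrix m m C) :
    (∑ q ∈ s, A q).map (fun x => g • x) = ∑ q ∈ s, (A q).map (fun x => g • x) := by
  ext i j
  simp only [Matrix.map_apply, Matrix.sum_apply, Finset.smul_sum]

omit [Fintype m] [DecidableEq m] in
/-- `g(h(A)) = (gh)(A)`. [folklore] -/
private theorem map_map_smul (g h : G) (A : Matrix m m C) :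
    (A.map fun x => h • x).map (fun x => g • x) = A.map fun x => (g * h) • x := by
  rw [Matrix.map_map]
  congr 1
  funext x
  exact (mul_smul g h x).symm

/-- `g(A) g(A⁻¹) = 1` for invertible `A`. [folklore] -/
private theorem map_mul_map_inv (g : G) {A : Matrix m m C} (hA : IsUnit A.det) :
    A.map (fun x => g • x) * A⁻¹.map (fun x => g • x) = 1 := by
  set f : C →+* C := MulSemiringAction.toRingHom G C g with hf_def
  have hf : (fun x : C => g • x) = ⇑f := by funext x; simp [hf_def]
  rw [hf, ← Matrix.map_mul, Matrix.mul_nonsing_inv A hA, Matrix.map_one f (map_zero f) (map_one f)]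

/-- The conjugate `σ ↦ M⁻¹ U_σ σ(M)` of a cocycle is a cocycle. [folklore] -/
private theorem cocycle_conj {U : G → Matrix m m C}
    (hU : ∀ g h, U (g * h) = U g * (U h).map fun x => g • x) {M : Matrix m m C} (hM : IsUnit M.det)
    (g h : G) :
    M⁻¹ * U (g * h) * M.map (fun x => (g * h) • x) =
      (M⁻¹ * U g * M.map fun x => g • x) * (M⁻¹ * U h * M.map fun x => h • x).map fun x => g • x := by
  set f : C →+* C := MulSemiringAction.toRingHom G C g with hf_def
  have hf : (fun x : C => g • x) = ⇑f := by funext x; simp [hf_def]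
  have hcancel : M.map ⇑f * M⁻¹.map ⇑f = 1 := by rw [← hf]; exact map_mul_map_inv g hM
  rw [hU g h, ← map_map_smul g h M, hf, Matrix.map_mul, Matrix.map_mul]
  calc M⁻¹ * (U g * (U h).map ⇑f) * ((M.map fun x => h • x).map ⇑f)
      = M⁻¹ * U g * 1 * (U h).map ⇑f * (M.map fun x => h • x).map ⇑f := by noncomm_ring
    _ = M⁻¹ * U g * (M.map ⇑f * M⁻¹.map ⇑f) * (U h).map ⇑f * (M.map fun x => h • x).map ⇑f := by
        rw [hcancel]
    _ = M⁻¹ * U g * M.map ⇑f * (M⁻¹.map ⇑f * (U h).map ⇑f * (M.map fun x => h • x).map ⇑f) := by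
        noncomm_ring

/-- An isometric action is continuous in the module variable. [folklore] -/
private theorem continuous_constSMul_of_norm_smul' (hiso : ∀ (g : G) (x : C), ‖g • x‖ = ‖x‖) (g : G) :
    Continuous fun x : C => g • x := by
  refine (Isometry.of_dist_eq fun x y => ?_).continuous
  rw [dist_eq_norm, dist_eq_norm, ← smul_sub, hiso]

/-- A matrix cocycle close to `1` has `U_1 = 1`. [folklore] -/
private theorem cocycle_apply_one {U : G → Matrix m m C}
    (hU : ∀ g h, U (g * h) = U g * (U h).map fun x => g • x) (h1 : IsUnit (U 1).det) : U 1 = 1 := by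
  have h := hU 1 1
  rw [mul_one] at h
  have hid : ((U 1).map fun x => (1 : G) • x) = U 1 := by
    ext i j; rw [Matrix.map_apply, one_smul]
  rw [hid] at h
  have h2 : (U 1)⁻¹ * (U 1 * U 1) = (U 1)⁻¹ * U 1 := by rw [← h]
  rwa [Matrix.nonsing_inv_mul_cancel_left _ _ h1, Matrix.nonsing_inv_mul _ h1] at h2

variable [TopologicalSpace G] [IsTopologicalGroup G] [CompactSpace G] [IsUltrametricDist C]

/-- **Berger–Colmez, Lemme 3.2.1 (one step of the `GL_d` Tate–Sen descent).** Let `σ ↦ U_σ` be a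
continuous `1`-cocycle `G → M_d(C)` (`U_{στ} = U_σ σ(U_τ)`) with `‖U_σ − 1‖ ≤ s` for all `σ`, where `K s < 1`
for the (TS1) constant `K ≥ 1`. Then there is `M ∈ GL_d(C)` with `‖M − 1‖ ≤ K s` and
`‖M⁻¹ U_σ σ(M) − 1‖ ≤ s/2` for all `σ`. (`M = ∑_{q ∈ G/U} q(α) U_q` for an open subgroup `U` on which
`‖U_σ − 1‖ < s/(2K)` and a trace-one `U`-invariant `α`.) [cite: BergerColmez2008, Lemme 3.2.1]
[cite: Tate1967, §3.2 Prop. 10] -/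
theorem GL_step (hiso : ∀ (g : G) (x : C), ‖g • x‖ = ‖x‖)
    (hbasis : ∀ V ∈ 𝓝 (1 : G), ∃ U : OpenSubgroup G, (U : Set G) ⊆ V)
    {K : ℝ} (hK : 1 ≤ K)
    (hTS : ∀ U : OpenSubgroup G, ∃ α : C, (∀ u ∈ U, u • α = α) ∧ ‖α‖ ≤ K ∧
      ∑ᶠ q : G ⧸ U.toSubgroup, q.out • α = 1)
    {U : G → Matrix m m C} (hU : ∀ g h, U (g * h) = U g * (U h).map fun x => g • x)
    (hcont : Continuous U) {s : ℝ} (hs : 0 < s) (hsK : K * s < 1)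
    (hbd : ∀ g i j, ‖(U g - 1) i j‖ ≤ s) :
    ∃ M : Matrix m m C, (∀ i j, ‖(M - 1) i j‖ ≤ K * s) ∧ IsUnit M.det ∧
      ∀ g i j, ‖(M⁻¹ * U g * M.map (fun x => g • x) - 1) i j‖ ≤ s / 2 := by
  have hK0 : 0 < K := lt_of_lt_of_le one_pos hK
  have hs1 : s < 1 := by nlinarith
  set δ : ℝ := s / (2 * K) with hδ
  have hδ0 : 0 < δ := div_pos hs (by positivity)
  -- `U_1 = 1`
  have hU1 : U 1 = 1 :=
    cocycle_apply_one hU (isUnit_det_and_norm_inv_le hs.le hs1 (hbd 1)).1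
  -- an open subgroup on which `U` is `δ`-close to `1`
  have hV : {g : G | ∀ i j, ‖(U g - 1) i j‖ < δ} ∈ 𝓝 (1 : G) := by
    refine IsOpen.mem_nhds ?_ fun i j => by rw [hU1, sub_self, Matrix.zero_apply, norm_zero]; exact hδ0
    simp only [Set.setOf_forall]
    refine isOpen_iInter_of_finite fun i => isOpen_iInter_of_finite fun j => ?_
    have hc : Continuous fun g => (U g - 1) i j :=
      ((hcont.matrix_elem i j).sub continuous_const : Continuous fun g => U g i j - (1 : Matrix m m C) i j)
    exact isOpen_lt hc.norm continuous_const
  obtain ⟨U₁, hU₁⟩ := hbasis _ hV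
  have hU₁δ : ∀ u ∈ U₁, ∀ i j, ‖(U u - 1) i j‖ < δ := fun u hu => hU₁ hu
  obtain ⟨α, hαU, hαK, hαtr⟩ := hTS U₁
  haveI : Fintype (G ⧸ U₁.toSubgroup) := Fintype.ofFinite _
  rw [finsum_eq_sum_of_fintype] at hαtr
  -- the averaging matrix
  set M : Matrix m m C := ∑ q : G ⧸ U₁.toSubgroup, (q.out • α) • U q.out with hM_def
  have hM1 : M - 1 = ∑ q : G ⧸ U₁.toSubgroup, (q.out • α) • (U q.out - 1) := by
    simp_rw [smul_sub]
    rw [Finset.sum_sub_distrib, ← Finset.sum_smul, hαtr, one_smul]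
  have hM1n : ∀ i j, ‖(M - 1) i j‖ ≤ K * s := by
    intro i j
    rw [hM1, Matrix.sum_apply]
    refine IsUltrametricDist.norm_sum_le_of_forall_le_of_nonneg (by positivity) fun q _ => ?_
    rw [Matrix.smul_apply, smul_eq_mul, norm_mul, hiso]
    exact mul_le_mul hαK (hbd _ i j) (norm_nonneg _) hK0.le
  obtain ⟨hdet, hMinv⟩ := isUnit_det_and_norm_inv_le (by positivity) hsK hM1n
  refine ⟨M, hM1n, hdet, fun h i j => ?_⟩
  -- coset bookkeeping: `(h • q).out = h * q.out * u_q` with `u_q ∈ U₁`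
  have hex : ∀ q : G ⧸ U₁.toSubgroup, ∃ u : U₁.toSubgroup, (h • q).out = h * q.out * u := by
    intro q
    have hq : h • q = (QuotientGroup.mk (h * q.out) : G ⧸ U₁.toSubgroup) := by
      conv_lhs => rw [← QuotientGroup.out_eq' q]
      rfl
    rw [hq]
    exact QuotientGroup.mk_out_eq_mul U₁.toSubgroup (h * q.out)
  choose u hu using hex
  -- `U_h h(M) = ∑_q ((h q) α) U_{h q}` and `h q = (h•q).out u_q⁻¹`
  have hterm : ∀ q : G ⧸ U₁.toSubgroup,
      ((h * q.out) • α) • U (h * q.out) =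
        ((h • q).out • α) • U (h • q).out +
          ((h • q).out • α) • (U (h • q).out *
            (U ((u q : G)⁻¹) - 1).map fun x => (h • q).out • x) := by
    intro q
    have h1 : h * q.out = (h • q).out * ((u q : G)⁻¹) := by rw [hu q, mul_inv_cancel_right]
    have hfix : (h * q.out) • α = (h • q).out • α := by
      rw [h1, mul_smul, hαU _ (U₁.toSubgroup.inv_mem (u q).2)]
    set σ' := (h • q).out
    set f : C →+* C := MulSemiringAction.toRingHom G C σ' with hf_def
    have hf : (fun x : C => σ' • x) = ⇑f := by funext x; simp [hf_def]
    rw [hfix, h1, hU, ← smul_add, hf, Matrix.map_sub f (map_sub f), Matrix.map_one f (map_zero f) (map_one f),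
      Matrix.mul_sub, Matrix.mul_one, add_sub_cancel]
  have hexp : U h * M.map (fun x => h • x) =
      M + ∑ q : G ⧸ U₁.toSubgroup, ((h • q).out • α) • (U (h • q).out *
        (U ((u q : G)⁻¹) - 1).map fun x => (h • q).out • x) := by
    rw [hM_def, map_sum_matrix, Finset.mul_sum]
    have h1 : ∀ q : G ⧸ U₁.toSubgroup, U h * ((q.out • α) • U q.out).map (fun x => h • x) =
        ((h * q.out) • α) • U (h * q.out) := by
      intro q
      rw [map_smul_matrix, Matrix.mul_smul, ← hU, mul_smul]
    simp_rw [h1, hterm, Finset.sum_add_distrib]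
    congr 1
    exact Fintype.sum_equiv (MulAction.toPerm h) _ _ fun q => rfl
  -- the error term is `≤ K δ = s / 2` entrywise
  have herr : ∀ i j, ‖(∑ q : G ⧸ U₁.toSubgroup, ((h • q).out • α) • (U (h • q).out *
      (U ((u q : G)⁻¹) - 1).map fun x => (h • q).out • x)) i j‖ ≤ s / 2 := by
    intro i j
    rw [Matrix.sum_apply]
    refine IsUltrametricDist.norm_sum_le_of_forall_le_of_nonneg (by positivity) fun q _ => ?_
    rw [Matrix.smul_apply, smul_eq_mul, norm_mul]
    have h1 : ∀ i j, ‖U (h • q).out i j‖ ≤ 1 := norm_apply_le_one_of_norm_sub_one_le hs1.le (hbd _)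
    have h2 : ∀ i j, ‖((U ((u q : G)⁻¹) - 1).map fun x => (h • q).out • x) i j‖ ≤ δ := fun i j => by
      rw [Matrix.map_apply, hiso]
      exact (hU₁δ _ (U₁.toSubgroup.inv_mem (u q).2) i j).le
    calc ‖(h • q).out • α‖ * ‖(U (h • q).out * (U ((u q : G)⁻¹) - 1).map fun x => (h • q).out • x) i j‖
        ≤ K * (1 * δ) := by
          rw [hiso]
          exact mul_le_mul hαK (norm_mul_apply_le zero_le_one hδ0.le h1 h2 i j) (norm_nonneg _) hK0.le
      _ = s / 2 := by rw [hδ]; field_simp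
  -- `M⁻¹ U_h h(M) − 1 = M⁻¹ · (error)`
  have hid : M⁻¹ * U h * M.map (fun x => h • x) - 1 =
      M⁻¹ * ∑ q : G ⧸ U₁.toSubgroup, ((h • q).out • α) • (U (h • q).out *
        (U ((u q : G)⁻¹) - 1).map fun x => (h • q).out • x) := by
    rw [Matrix.mul_assoc, hexp, Matrix.mul_add, Matrix.nonsing_inv_mul M hdet, add_sub_cancel_left]
  rw [hid]
  exact (norm_mul_apply_le zero_le_one (by positivity) hMinv herr i j).trans (le_of_eq (one_mul _))

variable [CompleteSpace C]

/-- ★ **Berger–Colmez, Cor. 3.2.2 (the `GL_d` Tate–Sen descent; Sen, Tate).** Let the compact group `G`, in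
which every neighbourhood of `1` contains an open subgroup, act on the complete ultrametric normed field
`C` by isometric ring automorphisms, continuously in the group variable, and satisfy (TS1) with constant
`K ≥ 1`. If `σ ↦ U_σ ∈ M_d(C)` is a continuous `1`-cocycle with `‖U_σ − 1‖ ≤ s` for all `σ` and `K s < 1`,
then there is `P ∈ GL_d(C)` with `‖P − 1‖ ≤ K s` and `P⁻¹ U_σ σ(P) = 1` for all `σ ∈ G`, i.e.
`U_σ = P σ(P)⁻¹` is a coboundary. [cite: BergerColmez2008, Lemme 3.2.1 and Cor. 3.2.2]
[cite: Sen1980, §1] [cite: Tate1967, §3.2 Prop. 10] -/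
theorem GL_exists_conj_eq_one_of_TS1 (hiso : ∀ (g : G) (x : C), ‖g • x‖ = ‖x‖)
    (hcontG : ∀ x : C, Continuous fun g : G => g • x)
    (hbasis : ∀ V ∈ 𝓝 (1 : G), ∃ U : OpenSubgroup G, (U : Set G) ⊆ V)
    {K : ℝ} (hK : 1 ≤ K)
    (hTS : ∀ U : OpenSubgroup G, ∃ α : C, (∀ u ∈ U, u • α = α) ∧ ‖α‖ ≤ K ∧
      ∑ᶠ q : G ⧸ U.toSubgroup, q.out • α = 1)
    (U : G → Matrix m m C) (hU : ∀ g h, U (g * h) = U g * (U h).map fun x => g • x)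
    (hcont : Continuous U) {s : ℝ} (hs : 0 < s) (hsK : K * s < 1)
    (hbd : ∀ g i j, ‖(U g - 1) i j‖ ≤ s) :
    ∃ P : Matrix m m C, (∀ i j, ‖(P - 1) i j‖ ≤ K * s) ∧ IsUnit P.det ∧
      ∀ g, P⁻¹ * U g * P.map (fun x => g • x) = 1 := by
  have hK0 : 0 < K := lt_of_lt_of_le one_pos hK
  have hKs0 : 0 ≤ K * s := by positivity
  have hhalf : ∀ k : ℕ, (1 / 2 : ℝ) ^ k ≤ 1 := fun k => pow_le_one₀ (by norm_num) (by norm_num)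
  -- the predicate carried along the iteration
  let Pr : ℕ → (G → Matrix m m C) → Prop := fun k U' =>
    (∀ g h, U' (g * h) = U' g * (U' h).map fun x => g • x) ∧ Continuous U' ∧
      ∀ g i j, ‖(U' g - 1) i j‖ ≤ s * (1 / 2) ^ k
  have hstep : ∀ (k : ℕ) (U' : {U' : G → Matrix m m C // Pr k U'}), ∃ M : Matrix m m C,
      (∀ i j, ‖(M - 1) i j‖ ≤ K * s * (1 / 2) ^ k) ∧ IsUnit M.det ∧
        Pr (k + 1) (fun g => M⁻¹ * U'.1 g * M.map fun x => g • x) := by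
    rintro k ⟨U', hU'1, hU'2, hU'3⟩
    have hsk : 0 < s * (1 / 2) ^ k := by positivity
    have hsKk : K * (s * (1 / 2) ^ k) < 1 := by
      calc K * (s * (1 / 2) ^ k) ≤ K * s * 1 := by
            rw [mul_assoc]; exact mul_le_mul_of_nonneg_left (mul_le_mul_of_nonneg_left (hhalf k) hs.le) hK0.le
        _ < 1 := by rw [mul_one]; exact hsK
    obtain ⟨M, hM1, hdet, hM2⟩ := GL_step hiso hbasis hK hTS hU'1 hU'2 hsk hsKk hU'3
    refine ⟨M, fun i j => (hM1 i j).trans (le_of_eq (mul_assoc _ _ _).symm), hdet,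
      cocycle_conj hU'1 hdet, ?_, fun g i j => ?_⟩
    · exact (continuous_const.matrix_mul hU'2).matrix_mul (continuous_matrix fun i j => hcontG (M i j))
    · refine (hM2 g i j).trans (le_of_eq ?_)
      rw [pow_succ]; ring
  choose MOf hMOf using hstep
  -- the sequences of corrected cocycles, step matrices and their products
  have hPr0 : Pr 0 U := ⟨hU, hcont, fun g i j => by rw [pow_zero, mul_one]; exact hbd g i j⟩
  let seq : (k : ℕ) → {U' : G → Matrix m m C // Pr k U'} := fun k =>
    Nat.rec (motive := fun k => {U' : G → Matrix m m C // Pr k U'}) ⟨U, hPr0⟩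
      (fun k prev => ⟨fun g => (MOf k prev)⁻¹ * prev.1 g * (MOf k prev).map fun x => g • x,
        (hMOf k prev).2.2⟩) k
  let Mseq : ℕ → Matrix m m C := fun k => MOf k (seq k)
  have hseq_succ : ∀ k g, (seq (k + 1)).1 g = (Mseq k)⁻¹ * (seq k).1 g * (Mseq k).map fun x => g • x :=
    fun k g => rfl
  have hMseq1 : ∀ k i j, ‖(Mseq k - 1) i j‖ ≤ K * s * (1 / 2) ^ k := fun k => (hMOf k (seq k)).1
  have hMseqdet : ∀ k, IsUnit (Mseq k).det := fun k => (hMOf k (seq k)).2.1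
  let Pseq : ℕ → Matrix m m C := fun k => Nat.rec 1 (fun k P => P * Mseq k) k
  have hP0 : Pseq 0 = 1 := rfl
  have hPsucc : ∀ k, Pseq (k + 1) = Pseq k * Mseq k := fun k => rfl
  -- `‖P_k − 1‖ ≤ K s`, `‖P_k‖ ≤ 1`, `det P_k` a unit
  have hP1 : ∀ k i j, ‖(Pseq k - 1) i j‖ ≤ K * s := by
    intro k
    induction k with
    | zero => intro i j; rw [hP0, sub_self, Matrix.zero_apply, norm_zero]; exact hKs0
    | succ k ih =>
      intro i j
      have hPle : ∀ i j, ‖Pseq k i j‖ ≤ 1 := norm_apply_le_one_of_norm_sub_one_le hsK.le ih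
      have h : Pseq (k + 1) - 1 = (Pseq k - 1) + Pseq k * (Mseq k - 1) := by
        rw [hPsucc]; noncomm_ring
      rw [h]
      refine (norm_add_apply_le ih (norm_mul_apply_le zero_le_one (by positivity) hPle (hMseq1 k)) i j).trans
        (max_le le_rfl ?_)
      rw [one_mul]
      exact (mul_le_mul_of_nonneg_left (hhalf k) hKs0).trans (le_of_eq (mul_one _))
  have hPle : ∀ k i j, ‖Pseq k i j‖ ≤ 1 := fun k => norm_apply_le_one_of_norm_sub_one_le hsK.le (hP1 k)
  have hPdet : ∀ k, IsUnit (Pseq k).det := fun k => (isUnit_det_and_norm_inv_le hKs0 hsK (hP1 k)).1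
  -- `U_k(g) = P_k⁻¹ U(g) g(P_k)`
  have hconj : ∀ k g, (seq k).1 g = (Pseq k)⁻¹ * U g * (Pseq k).map fun x => g • x := by
    intro k
    induction k with
    | zero =>
      intro g
      show U g = (Pseq 0)⁻¹ * U g * (Pseq 0).map fun x => g • x
      rw [hP0, inv_one, Matrix.one_mul]
      have h1 : ((1 : Matrix m m C).map fun x => g • x) = 1 := by
        set f : C →+* C := MulSemiringAction.toRingHom G C g with hf_def
        have hf : (fun x : C => g • x) = ⇑f := by funext x; simp [hf_def]
        rw [hf, Matrix.map_one f (map_zero f) (map_one f)]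
      rw [h1, Matrix.mul_one]
    | succ k ih =>
      intro g
      set f : C →+* C := MulSemiringAction.toRingHom G C g with hf_def
      have hf : (fun x : C => g • x) = ⇑f := by funext x; simp [hf_def]
      rw [hseq_succ, ih, hPsucc, Matrix.mul_inv_rev, hf, Matrix.map_mul]
      noncomm_ring
  -- the products converge
  have hdist : ∀ i j k, dist (Pseq k i j) (Pseq (k + 1) i j) ≤ K * s * (1 / 2 : ℝ) ^ k := by
    intro i j k
    rw [dist_eq_norm, ← norm_neg, neg_sub, ← Matrix.sub_apply, hPsucc,
      show Pseq k * Mseq k - Pseq k = Pseq k * (Mseq k - 1) by noncomm_ring]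
    exact (norm_mul_apply_le zero_le_one (by positivity) (hPle k) (hMseq1 k) i j).trans (le_of_eq (one_mul _))
  choose Pl hPl using fun i j =>
    cauchySeq_tendsto_of_complete (cauchySeq_of_le_geometric (1 / 2 : ℝ) (K * s) (by norm_num) (hdist i j))
  set P : Matrix m m C := fun i j => Pl i j with hP_def
  have hPlim : Tendsto Pseq atTop (𝓝 P) :=
    tendsto_pi_nhds.mpr fun i => tendsto_pi_nhds.mpr fun j => hPl i j
  have hPfin1 : ∀ i j, ‖(P - 1) i j‖ ≤ K * s := by
    intro i j
    rw [Matrix.sub_apply]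
    refine le_of_tendsto ((continuous_norm.tendsto _).comp
      ((hPl i j).sub_const ((1 : Matrix m m C) i j))) (Eventually.of_forall fun k => ?_)
    have h := hP1 k i j
    rwa [Matrix.sub_apply] at h
  have hPfindet : IsUnit P.det := (isUnit_det_and_norm_inv_le hKs0 hsK hPfin1).1
  refine ⟨P, hPfin1, hPfindet, fun g => ?_⟩
  -- pass to the limit in `U_k(g) = P_k⁻¹ U(g) g(P_k)`, `‖U_k(g) − 1‖ ≤ s 2^{-k}`
  have hinvcont : ContinuousAt Ring.inverse P.det := by
    obtain ⟨v, hv⟩ := hPfindet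
    rw [← hv]; exact NormedRing.inverse_continuousAt v
  have hlim_inv : Tendsto (fun k => (Pseq k)⁻¹) atTop (𝓝 P⁻¹) :=
    ((continuousAt_matrix_inv P hinvcont).tendsto).comp hPlim
  have hlim_map : Tendsto (fun k => (Pseq k).map fun x => g • x) atTop (𝓝 (P.map fun x => g • x)) :=
    ((continuous_id.matrix_map (continuous_constSMul_of_norm_smul' hiso g)).tendsto P).comp hPlim
  have hlim : Tendsto (fun k => (Pseq k)⁻¹ * U g * (Pseq k).map fun x => g • x) atTop
      (𝓝 (P⁻¹ * U g * P.map fun x => g • x)) := (hlim_inv.mul tendsto_const_nhds).mul hlim_map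
  ext i j
  have hlim_ij : Tendsto (fun k => ((Pseq k)⁻¹ * U g * (Pseq k).map fun x => g • x) i j) atTop
      (𝓝 ((P⁻¹ * U g * P.map fun x => g • x) i j)) := tendsto_pi_nhds.mp (tendsto_pi_nhds.mp hlim i) j
  have hsmall : ∀ k, ‖((Pseq k)⁻¹ * U g * (Pseq k).map (fun x => g • x)) i j - (1 : Matrix m m C) i j‖ ≤
      s * (1 / 2 : ℝ) ^ k := by
    intro k
    rw [← Matrix.sub_apply, ← hconj k g]
    exact (seq k).2.2.2 g i j
  have hgeo : Tendsto (fun k : ℕ => s * (1 / 2 : ℝ) ^ k) atTop (𝓝 0) := by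
    have h := (tendsto_pow_atTop_nhds_zero_of_lt_one (by norm_num : (0 : ℝ) ≤ 1 / 2)
      (by norm_num : (1 / 2 : ℝ) < 1)).const_mul s
    rwa [mul_zero] at h
  have hlim0 : Tendsto (fun k => ((Pseq k)⁻¹ * U g * (Pseq k).map (fun x => g • x)) i j -
      (1 : Matrix m m C) i j) atTop (𝓝 0) := squeeze_zero_norm hsmall hgeo
  have hlim1 : Tendsto (fun k => ((Pseq k)⁻¹ * U g * (Pseq k).map (fun x => g • x)) i j -
      (1 : Matrix m m C) i j) atTop (𝓝 ((P⁻¹ * U g * P.map fun x => g • x) i j - (1 : Matrix m m C) i j)) :=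
    hlim_ij.sub_const _
  exact sub_eq_zero.mp (tendsto_nhds_unique hlim1 hlim0)

end Abstract

end Literature.NumberTheory.PAdicHodge.TateSen
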